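import Summits.ResolutionOfSingularities.ResolutionOfSingularities.Theorems.AbsoluteQFrameLinearPart
import HarnessLib

/-!
# AbsoluteQFrame — decomp-res node «AbsoluteContactInsep» (lens-6 g18), tree file 2/10 of the node

Content VERBATIM from the decomp-res lens-6 g18 file `HOME/decomp-res-lens-6/g18/AbsoluteContactInsep.lean` (sha256
3771488be5d3cd2c, 1966 l; HOME =
run/shared/lean/pub/decomp-res).  Critic: CRITIC-LEDGER row 139 (CLEARED 2026-08-30T20:11:48Z, DECIDED +1:
`AbsContactOff3` proved for every p ≠ 3 and every
field, hypothesis-free); split per the lens's NODE-g18 §8 writer package (sections kept whole; two packages halved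
for the 400-line limit).  Landed by
decomp-res writer g7 in the lens's namespace `…Theorems.AbsoluteContactClasses` (cone-free chain); the wiring
`Theorems/MaxContactCutAbsContactOff3`
(`agAbsContactOff3 : AGAbsContactOff3`, item 27752) follows the chain.  No new aside, nothing superseded; asides
31574 / 27753 / 27896 are ⟺ each other
hypothesis-free by this node.

Section `QFrame` (l. 395–604): `IsQFrame` and its API, `exists_isDiffOpLE_of_isQFrame`.

[WRITER NOTE (decomp-res writer g7): file split only; namespace, opens, section variables and every declaration
exactly as in the lens (global `set_option` dropped).]

(Sources: Giraud1975; EGA IV 16.11.2, 0_IV 21.9; KimuraNiitsuma1980 Thm 3.4; EncinasVillamayor2000 Thm 4.9;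
BravoGarciaEscamillaVillamayor2012 Lemma 4.6; Hironaka1964; CossartJannsenSaito2020; CossartPiltant2019; Kunz1969.)
-/

noncomputable section

open CategoryTheory AlgebraicGeometry TopologicalSpace
open Literature.AlgebraicGeometry.Resolution
open Summit.ResolutionOfSingularities.ResolutionOfSingularities.Theorems
open WeakOrderReduction ForcedTowerClasses PurityValveClasses
open SatelliteExitClasses
open IsLocalRing MvPolynomial

namespace Summit.ResolutionOfSingularities.ResolutionOfSingularities.Theorems.AbsoluteContactClasses

section QFrame

/-! ## Absolute `q`-frames and the truncated Taylor morphism -/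

variable {R : Type*} [CommRing R] {d : ℕ}

/-- The box monomial `u^γ = ∏ i, u i ^ γ i` for a digit vector `γ : Fin d → Fin q`. -/
def boxMon (q : ℕ) (u : Fin d → R) (γ : Fin d → Fin q) : R := ∏ i, u i ^ (γ i : ℕ)

/-- The Taylor polynomial `∏ i, (u i + X i) ^ γ i` of the box monomial `u^γ`. -/
def taylorMon (q : ℕ) (u : Fin d → R) (γ : Fin d → Fin q) : MvPolynomial (Fin d) R :=
  ∏ i, (C (u i) + X i) ^ (γ i : ℕ)

/-- An **absolute `q`-frame** of `R` at `u`: a subring `Cq` containing every `q`-th power, over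
which `R` is free on the box monomials `u^γ`, `γ ∈ [0,q)^d`. For `R` regular local of
characteristic `p`, essentially of finite type over a field (any residue field, separable or
not) and `u` a regular system of parameters, such frames exist with `q = p^e`
(Kunz; Matsumura, CRT Thm. 30.6 for the shape of the statement); no base field enters. -/
structure IsQFrame (q : ℕ) (Cq : Subring R) (u : Fin d → R) : Prop where
  pow_mem : ∀ r : R, r ^ q ∈ Cq
  linearIndependent : LinearIndependent Cq (boxMon q u)
  top_le_span : ⊤ ≤ Submodule.span Cq (Set.range (boxMon q u))

/-- `prod_pow_update`: Auxiliary step of this node's calculus, VERBATIM from the lens file (see the module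
docstring); the statement is its type. [folklore] -/
theorem prod_pow_update {M : Type*} [CommMonoid M] (w : Fin d → M) (e : Fin d → ℕ) (i : Fin d)
    (v : ℕ) : ∏ j, w j ^ Function.update e i v j = w i ^ v * ∏ j ∈ Finset.univ.erase i, w j ^ e j := by
  rw [← Finset.mul_prod_erase Finset.univ _ (Finset.mem_univ i), Function.update_self]
  congr 1
  exact Finset.prod_congr rfl fun j hj => by rw [Function.update_of_ne (Finset.ne_of_mem_erase hj)]

/-- `prod_pow_eq_mul_erase`: Auxiliary step of this node's calculus, VERBATIM from the lens file (see the module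
docstring); the statement is its type. [folklore] -/
theorem prod_pow_eq_mul_erase {M : Type*} [CommMonoid M] (w : Fin d → M) (e : Fin d → ℕ)
    (i : Fin d) : ∏ j, w j ^ e j = w i ^ e i * ∏ j ∈ Finset.univ.erase i, w j ^ e j :=
  (Finset.mul_prod_erase Finset.univ _ (Finset.mem_univ i)).symm

/-- `coe_update`: Auxiliary step of this node's calculus, VERBATIM from the lens file (see the module docstring);
the statement is its type. [folklore] -/
theorem coe_update {q : ℕ} (γ : Fin d → Fin q) (i : Fin d) (v : Fin q) :
    (fun j => ((Function.update γ i v j : Fin q) : ℕ)) = Function.update (fun j => (γ j : ℕ)) i (v : ℕ) := by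
  funext j
  by_cases h : j = i
  · subst h; simp
  · simp [Function.update_of_ne h]

namespace IsQFrame

variable {q : ℕ} {Cq : Subring R} {u : Fin d → R} (hF : IsQFrame q Cq u)
include hF

/-- The `Cq`-basis of box monomials. -/
def basis : Module.Basis (Fin d → Fin q) Cq R := Module.Basis.mk hF.linearIndependent hF.top_le_span

/-- `basis_apply`: Auxiliary step of this node's calculus, VERBATIM from the lens file (see the module docstring);
the statement is its type. [folklore] -/
@[simp] theorem basis_apply (γ : Fin d → Fin q) : hF.basis γ = boxMon q u γ :=
  Module.Basis.mk_apply _ _ _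

/-- The `Cq`-linear Taylor map `Σ c_γ u^γ ↦ Σ c_γ (u + X)^γ`. -/
def taylorLin : R →ₗ[Cq] MvPolynomial (Fin d) R := hF.basis.constr ℕ (taylorMon q u)

/-- `taylorLin_boxMon`: Auxiliary step of this node's calculus, VERBATIM from the lens file (see the module
docstring); the statement is its type. [folklore] -/
theorem taylorLin_boxMon (γ : Fin d → Fin q) : hF.taylorLin (boxMon q u γ) = taylorMon q u γ := by
  rw [← hF.basis_apply, taylorLin, Module.Basis.constr_basis]

/-- The Taylor map followed by truncation at `(X)^q`. -/
def taylorLinQ : R →ₗ[Cq] (MvPolynomial (Fin d) R ⧸ idealOfVars (Fin d) R ^ q) :=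
  (Ideal.Quotient.mkₐ Cq (idealOfVars (Fin d) R ^ q)).toLinearMap ∘ₗ hF.taylorLin

/-- `taylorLinQ_apply`: Auxiliary step of this node's calculus, VERBATIM from the lens file (see the module
docstring); the statement is its type. [folklore] -/
theorem taylorLinQ_apply (r : R) :
    hF.taylorLinQ r = Ideal.Quotient.mk _ (hF.taylorLin r) := rfl

/-- The key computation: `T(u_i · x) = (u_i + X_i) · T(x)` modulo `(X)^q`, because
`(u_i + X_i)^q = u_i^q + X_i^q` in characteristic `p` (`q = p^n`) and `u_i^q ∈ Cq` is a scalar. [folklore] -/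
theorem taylorLinQ_u_mul (p n : ℕ) [Fact p.Prime] [CharP R p] (hq : q = p ^ n) (i : Fin d) (x : R) :
    hF.taylorLinQ (u i * x) = Ideal.Quotient.mk _ (C (u i) + X i) * hF.taylorLinQ x := by
  classical
  have hq0 : 0 < q := hq ▸ Nat.pos_of_ne_zero (pow_ne_zero n (Fact.out : p.Prime).ne_zero)
  let f₁ : R →ₗ[Cq] (MvPolynomial (Fin d) R ⧸ idealOfVars (Fin d) R ^ q) :=
    hF.taylorLinQ ∘ₗ LinearMap.mulLeft Cq (u i)
  let f₂ : R →ₗ[Cq] (MvPolynomial (Fin d) R ⧸ idealOfVars (Fin d) R ^ q) :=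
    LinearMap.mulLeft Cq (Ideal.Quotient.mk (idealOfVars (Fin d) R ^ q) (C (u i) + X i)) ∘ₗ
      hF.taylorLinQ
  suffices f₁ = f₂ from LinearMap.congr_fun this x
  refine hF.basis.ext fun γ => ?_
  simp only [f₁, f₂, LinearMap.comp_apply, LinearMap.mulLeft_apply, basis_apply, taylorLinQ_apply]
  by_cases hlt : (γ i : ℕ) + 1 < q
  · set γ' : Fin d → Fin q := Function.update γ i ⟨(γ i : ℕ) + 1, hlt⟩ with hγ'
    have h1 : u i * boxMon q u γ = boxMon q u γ' := by
      rw [boxMon, boxMon, show (fun j => u j ^ ((γ' j : Fin q) : ℕ)) =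
          fun j => u j ^ Function.update (fun j => (γ j : ℕ)) i (((⟨(γ i : ℕ) + 1, hlt⟩ : Fin q)) : ℕ) j
        from by funext j; rw [← coe_update]]
      rw [prod_pow_update, prod_pow_eq_mul_erase u _ i, pow_succ]
      ring
    have h2 : taylorMon q u γ' = (C (u i) + X i) * taylorMon q u γ := by
      rw [taylorMon, taylorMon, show (fun j => (C (u j) + X j) ^ ((γ' j : Fin q) : ℕ)) =
          fun j => (C (u j) + X j) ^ Function.update (fun j => (γ j : ℕ)) i
            (((⟨(γ i : ℕ) + 1, hlt⟩ : Fin q)) : ℕ) j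
        from by funext j; rw [← coe_update]]
      rw [prod_pow_update, prod_pow_eq_mul_erase (fun j => C (u j) + X j) _ i, pow_succ]
      ring
    rw [h1, taylorLin_boxMon, h2, map_mul, taylorLin_boxMon]
  · have heq : (γ i : ℕ) + 1 = q := by have := (γ i).isLt; omega
    set γ' : Fin d → Fin q := Function.update γ i ⟨0, hq0⟩ with hγ'
    set c : Cq := ⟨u i ^ q, hF.pow_mem _⟩ with hc
    have h1 : u i * boxMon q u γ = c • boxMon q u γ' := by
      rw [Subring.smul_def, smul_eq_mul, boxMon, boxMon,
        show (fun j => u j ^ ((γ' j : Fin q) : ℕ)) =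
          fun j => u j ^ Function.update (fun j => (γ j : ℕ)) i (((⟨0, hq0⟩ : Fin q)) : ℕ) j
        from by funext j; rw [← coe_update]]
      have hcq : u i * u i ^ (γ i : ℕ) = (c : R) := by rw [← pow_succ', heq]
      rw [prod_pow_update, prod_pow_eq_mul_erase u _ i, pow_zero, one_mul, ← mul_assoc, hcq]
    have h2 : (C (u i) + X i) * taylorMon q u γ =
        C (u i ^ q) * taylorMon q u γ' + X i ^ q * taylorMon q u γ' := by
      rw [taylorMon, taylorMon, show (fun j => (C (u j) + X j) ^ ((γ' j : Fin q) : ℕ)) =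
          fun j => (C (u j) + X j) ^ Function.update (fun j => (γ j : ℕ)) i
            (((⟨0, hq0⟩ : Fin q)) : ℕ) j
        from by funext j; rw [← coe_update]]
      rw [prod_pow_update, prod_pow_eq_mul_erase (fun j => C (u j) + X j) _ i, pow_zero, one_mul,
        ← mul_assoc, ← pow_succ', heq, ← add_mul, map_pow]
      congr 1
      rw [hq]
      exact add_pow_char_pow _ _ _ _
    rw [h1, map_smul, taylorLin_boxMon, taylorLin_boxMon, ← map_mul, h2, map_add, Subring.smul_def,
      smul_eq_C_mul]
    have hX : X i ^ q * taylorMon q u γ' ∈ idealOfVars (Fin d) R ^ q := by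
      refine Ideal.mul_mem_right _ _ (Ideal.pow_mem_pow ?_ q)
      exact Ideal.subset_span (Set.mem_range_self i)
    rw [Ideal.Quotient.eq_zero_iff_mem.mpr hX, add_zero]

/-- `taylorLinQ_one`: Auxiliary step of this node's calculus, VERBATIM from the lens file (see the module
docstring); the statement is its type. [folklore] -/
theorem taylorLinQ_one (hq : 0 < q) : hF.taylorLinQ 1 = 1 := by
  have h1 : (1 : R) = boxMon q u (fun _ => ⟨0, hq⟩) := by simp [boxMon]
  rw [taylorLinQ_apply, h1, taylorLin_boxMon]
  simp [taylorMon]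

/-- `taylorLinQ_u`: Auxiliary step of this node's calculus, VERBATIM from the lens file (see the module docstring);
the statement is its type. [folklore] -/
theorem taylorLinQ_u (p n : ℕ) [Fact p.Prime] [CharP R p] (hq : q = p ^ n) (i : Fin d) :
    hF.taylorLinQ (u i) = Ideal.Quotient.mk _ (C (u i) + X i) := by
  have hq0 : 0 < q := hq ▸ Nat.pos_of_ne_zero (pow_ne_zero n (Fact.out : p.Prime).ne_zero)
  have := hF.taylorLinQ_u_mul p n hq i 1
  rwa [mul_one, hF.taylorLinQ_one hq0, mul_one] at this

/-- `taylorLinQ_mul`: Auxiliary step of this node's calculus, VERBATIM from the lens file (see the module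
docstring); the statement is its type. [folklore] -/
theorem taylorLinQ_mul (p n : ℕ) [Fact p.Prime] [CharP R p] (hq : q = p ^ n) (a x : R) :
    hF.taylorLinQ (a * x) = hF.taylorLinQ a * hF.taylorLinQ x := by
  classical
  have hq0 : 0 < q := hq ▸ Nat.pos_of_ne_zero (pow_ne_zero n (Fact.out : p.Prime).ne_zero)
  have key : ∀ m ∈ Submonoid.closure (Set.range u), ∀ y : R,
      hF.taylorLinQ (m * y) = hF.taylorLinQ m * hF.taylorLinQ y := by
    intro m hm
    induction hm using Submonoid.closure_induction with
    | mem m hm =>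
      obtain ⟨i, rfl⟩ := hm
      intro y
      rw [hF.taylorLinQ_u_mul p n hq, hF.taylorLinQ_u p n hq]
    | one => intro y; rw [one_mul, hF.taylorLinQ_one hq0, one_mul]
    | mul a a' _ _ iha iha' =>
      intro y
      rw [mul_assoc, iha, iha', iha a', mul_assoc]
  let g₁ : R →ₗ[Cq] (MvPolynomial (Fin d) R ⧸ idealOfVars (Fin d) R ^ q) :=
    hF.taylorLinQ ∘ₗ LinearMap.mulRight Cq x
  let g₂ : R →ₗ[Cq] (MvPolynomial (Fin d) R ⧸ idealOfVars (Fin d) R ^ q) :=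
    LinearMap.mulRight Cq (hF.taylorLinQ x) ∘ₗ hF.taylorLinQ
  suffices g₁ = g₂ from LinearMap.congr_fun this a
  refine hF.basis.ext fun γ => ?_
  simp only [g₁, g₂, LinearMap.comp_apply, LinearMap.mulRight_apply, basis_apply]
  refine key _ ?_ x
  unfold boxMon
  refine prod_mem fun i _ => Submonoid.pow_mem _ ?_ _
  exact Submonoid.subset_closure (Set.mem_range_self i)

/-- **The truncated Taylor morphism** `R → R[X]/(X)^q` of an absolute `q`-frame: a ring map. -/
def taylorHom (p n : ℕ) [Fact p.Prime] [CharP R p] (hq : q = p ^ n) :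
    R →+* MvPolynomial (Fin d) R ⧸ idealOfVars (Fin d) R ^ q where
  toFun := hF.taylorLinQ
  map_one' := hF.taylorLinQ_one (hq ▸ Nat.pos_of_ne_zero (pow_ne_zero n (Fact.out : p.Prime).ne_zero))
  map_mul' := hF.taylorLinQ_mul p n hq
  map_zero' := map_zero _
  map_add' := map_add _

/-- `taylorHom_apply`: Auxiliary step of this node's calculus, VERBATIM from the lens file (see the module
docstring); the statement is its type. [folklore] -/
theorem taylorHom_apply (p n : ℕ) [Fact p.Prime] [CharP R p] (hq : q = p ^ n) (r : R) :
    hF.taylorHom p n hq r = hF.taylorLinQ r := rfl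

/-- `taylorHom_u`: Auxiliary step of this node's calculus, VERBATIM from the lens file (see the module docstring);
the statement is its type. [folklore] -/
theorem taylorHom_u (p n : ℕ) [Fact p.Prime] [CharP R p] (hq : q = p ^ n) (i : Fin d) :
    hF.taylorHom p n hq (u i) = Ideal.Quotient.mk _ (C (u i) + X i) :=
  hF.taylorLinQ_u p n hq i

/-- The Taylor morphism has constant term the identity. [folklore] -/
theorem truncCoeff_zero_taylorHom (p n : ℕ) [Fact p.Prime] [CharP R p] (hq : q = p ^ n) (r : R) :
    TruncPoly.truncCoeff R (Fin d) q 0 (hF.taylorHom p n hq r) = r := by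
  classical
  have hq0 : 0 < q := hq ▸ Nat.pos_of_ne_zero (pow_ne_zero n (Fact.out : p.Prime).ne_zero)
  let t : R →ₗ[Cq] R := ((TruncPoly.truncCoeff R (Fin d) q 0).restrictScalars Cq) ∘ₗ hF.taylorLinQ
  suffices t = LinearMap.id from LinearMap.congr_fun this r
  refine hF.basis.ext fun γ => ?_
  simp only [t, LinearMap.comp_apply, LinearMap.restrictScalars_apply, basis_apply, taylorLinQ_apply,
    taylorLin_boxMon, LinearMap.id_apply]
  rw [TruncPoly.truncCoeff_mk_of_lt (by simpa using hq0), ← constantCoeff_eq, taylorMon, map_prod, boxMon]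
  exact Finset.prod_congr rfl fun i _ => by simp

end IsQFrame

/-- **Part A.** An absolute `q`-frame (`q = p^n`) at a generating family `u` of the maximal
ideal yields, for every `h ∈ 𝔪^{N+1} ∖ 𝔪^{N+2}` with `p ∤ N+1` and `N + 1 < q`, an absolute
(`ℤ`-linear) differential operator of order `≤ N` with `D h ∈ 𝔪 ∖ 𝔪²`. [folklore] -/
theorem exists_isDiffOpLE_of_isQFrame [IsLocalRing R] (p n : ℕ) [Fact p.Prime] [CharP R p]
    {q : ℕ} {Cq : Subring R} {u : Fin d → R} (hF : IsQFrame q Cq u) (hq : q = p ^ n)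
    (hu : Ideal.span (Set.range u) = maximalIdeal R) {N : ℕ} (hN : N + 1 < q) {h : R}
    (h1 : h ∈ maximalIdeal R ^ (N + 1)) (h2 : h ∉ maximalIdeal R ^ (N + 2)) (hpN : ¬ p ∣ N + 1) :
    ∃ D : R →ₗ[ℤ] R, IsDiffOpLE ℤ N D ∧ D h ∈ maximalIdeal R ∧ D h ∉ maximalIdeal R ^ 2 := by
  classical
  set ψ := (hF.taylorHom p n hq).toIntAlgHom with hψ
  have hψ0 : ∀ g, TruncPoly.truncCoeff R (Fin d) q 0 (ψ g) = g := hF.truncCoeff_zero_taylorHom p n hq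
  have hψu : ∀ i, ψ (u i) = Ideal.Quotient.mk _ (C (u i) + X i) := hF.taylorHom_u p n hq
  obtain ⟨α, hα, hm, hm2⟩ := exists_hsCoeff_mem_not_mem_sq ψ u p hu hψ0 hψu hN h1 h2 hpN
  exact ⟨_, TruncPoly.isDiffOpLE_hsCoeff ψ hψ0 N α hα (by omega), hm, hm2⟩

end QFrame

end Summit.ResolutionOfSingularities.ResolutionOfSingularities.Theorems.AbsoluteContactClasses
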